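import Mathlib
import Literature.Analysis.FluidPDE.ClassicalSpeedBoundIncrements
import Summits.NavierStokesRegularity.NavierStokesRegularity.Theorems.LevelSetModerationLevelSetClosure

/-!
# Route LevelSetModeration — crux 2 `HighSpeedPressureWork`: the occupation quantum `κ ν⁴/G⁵`

Support lemma for item stmt-NavierStokesRegularity-18149 (`HighSpeedPressureWork`), step (ii) of the
round-2 crux idea `iso-speed-area-closure` (`OccupationQuantum`): for a member of the data class that
is bounded by `G` on `[0, T'] × ℝ³` and reaches speed `≥ 3G/4` at some `(t₁, x₁)` with
`3ν/G² ≤ t₁ < T'`, the occupation above level `G/2` is at least ONE viscous cell: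

  `∫₀^{T'} |{|u(τ)| > G/2}| dτ ≥ κ ν⁴ / G⁵`, `κ > 0` absolute.

Mechanism (the quantitative smoothing bricks of `ClassicalGradientSmoothing` /
`ClassicalSpeedBoundIncrements`, all landed): `‖∇u(t₁)‖ ≤ C_g G²/ν` keeps `|u(t₁, ·)| ≥ 3G/4 − G/16` on
the ball of radius `ν/(16 C_g G)` around `x₁`, and the time increments
`‖u(t₁, x) − u(τ, x)‖ ≤ C_i G² √((t₁ − τ)/ν) ≤ G/8` keep `|u| > G/2` there for
`τ ∈ (t₁ − κ₁ν/G², t₁]`; the cell has measure `κ₁ (ν/G²) · ω₃ (ν/(16 C_g G))³`.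
-/

noncomputable section

-- single-conjunct summit: `Summit.<Summit>.<Problem>` repeats the name by the D-0017 layout
set_option linter.dupNamespace false

namespace Summit.NavierStokesRegularity.NavierStokesRegularity.Theorems

open MeasureTheory Set Filter Topology Function Metric
open scoped ENNReal NNReal
open Literature.Analysis.FluidPDE

/-- **THE OCCUPATION QUANTUM** (step (ii) of idea `iso-speed-area-closure`). There is an absolute
constant `κ > 0` such that: for every classical solution on `ℝ³ × [0,T)` (`ν > 0`) that is Leray–Hopf
from a rapidly decaying datum, bounded by `G > 0` on `[0, T'] × ℝ³` (`0 < T' < T`), and every point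
`(t₁, x₁)` with `3ν/G² ≤ t₁ < T'` and `‖u(t₁, x₁)‖ ≥ 3G/4`, the occupation above `G/2` satisfies
`ofReal (κ ν⁴/G⁵) ≤ ∫₀^{T'} |{x | G/2 < ‖u(τ, x)‖}| dτ` (one parabolic cell
`(t₁ − κ₁ν/G², t₁] × B(x₁, ν/(16C_g G))` lies inside the super-level set, by the gradient bound
`exists_norm_fderiv_le_of_speed_le_delay` and the time increments `exists_norm_sub_le_of_speed_le_delay`).
[folklore] -/
theorem levelSetModeration_occupationQuantum :
    ∃ κ : ℝ, 0 < κ ∧ ∀ (ν T : ℝ) (u : ℝ → EuclideanSpace ℝ (Fin 3) → EuclideanSpace ℝ (Fin 3)) (p : ℝ → EuclideanSpace ℝ (Fin 3) → ℝ), 0 < ν → 0 < T → Literature.Analysis.FluidPDE.IsClassicalNSSolutionOn (Set.Ico 0 T) ν 0 u p → Literature.Analysis.FluidPDE.IsLerayHopfOn T ν 0 (u 0) u → Literature.Analysis.FluidPDE.HasRapidSpatialDecay (u 0) → ∀ (T' G : ℝ), 0 < T' → T' < T → 0 < G → (∀ t ∈ Set.Icc 0 T', ∀ x, ‖u t x‖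 ≤ G) → ∀ (t₁ : ℝ) (x₁ : EuclideanSpace ℝ (Fin 3)), 3 * ν / G ^ 2 ≤ t₁ → t₁ < T' → 3 * G / 4 ≤ ‖u t₁ x₁‖ → ENNReal.ofReal (κ * ν ^ 4 / G ^ 5) ≤ ∫⁻ τ in Set.Ioo 0 T', MeasureTheory.volume {x | G / 2 < ‖u τ x‖} := by
  -- the two smoothing bricks with delay `1`
  obtain ⟨Cg, hCg⟩ := exists_norm_fderiv_le_of_speed_le_delay (d := 1) one_pos
  obtain ⟨Ci, hCi⟩ := exists_norm_sub_le_of_speed_le_delay (d := 1) one_pos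
  set Cg' : ℝ := max Cg 1 with hCg'
  set Ci' : ℝ := max Ci 1 with hCi'
  have hCg'1 : 1 ≤ Cg' := le_max_right _ _
  have hCi'1 : 1 ≤ Ci' := le_max_right _ _
  have hCg'0 : 0 < Cg' := by linarith
  have hCi'0 : 0 < Ci' := by linarith
  -- time fraction `κ₁ = 1/(64 Ci'²) ≤ 1`, radius factor `1/(16 Cg')`
  set κ₁ : ℝ := 1 / (64 * Ci' ^ 2) with hκ₁
  have hκ₁pos : 0 < κ₁ := by rw [hκ₁]; positivity
  have hκ₁le : κ₁ ≤ 1 := by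
    rw [hκ₁, div_le_one (by positivity)]; nlinarith
  -- the unit ball volume
  set ω : ℝ≥0∞ := volume (ball (0 : EuclideanSpace ℝ (Fin 3)) 1) with hω
  have hωpos : 0 < ω := measure_ball_pos volume _ one_pos
  have hωtop : ω ≠ ∞ := measure_ball_lt_top.ne
  have hωreal : 0 < ω.toReal := ENNReal.toReal_pos hωpos.ne' hωtop
  refine ⟨κ₁ * (1 / (16 * Cg')) ^ 3 * ω.toReal, by positivity, ?_⟩
  intro ν T u p hν hT hcl hLH hdec T' G hT' hT'T hG hbd t₁ x₁ ht₁ ht₁T' hspeed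
  have hG2 : 0 < G ^ 2 := by positivity
  -- uniform `L²` bound of the slices
  set K : ℝ≥0∞ := (ENNReal.ofReal (∫ x, ‖u 0 x‖ ^ 2)) ^ (1 / 2 : ℝ) with hK
  have hKtop : K ≠ ∞ := ENNReal.rpow_ne_top_of_nonneg (by norm_num) ENNReal.ofReal_ne_top
  have hL2 : ∀ t ∈ Icc 0 T', eLpNorm (u t) 2 volume ≤ K := by
    intro t ht
    have htT : t ∈ Icc 0 T := ⟨ht.1, ht.2.trans hT'T.le⟩
    have h := lintegral_enorm_sq_le_of_lerayHopf hLH hν.le htT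
    rw [eLpNorm_eq_lintegral_rpow_enorm_toReal (by norm_num) (by norm_num), ENNReal.toReal_ofNat, hK]
    refine ENNReal.rpow_le_rpow ?_ (by norm_num)
    refine le_trans (le_of_eq ?_) h
    refine lintegral_congr fun x => ?_
    rw [ENNReal.rpow_two]
  -- the cell parameters
  set τ₀ : ℝ := κ₁ * ν / G ^ 2 with hτ₀
  set r : ℝ := ν / (16 * Cg' * G) with hr
  have hτ₀pos : 0 < τ₀ := by rw [hτ₀]; positivity
  have hrpos : 0 < r := by rw [hr]; positivity
  have hτ₀le : τ₀ ≤ ν / G ^ 2 := by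
    rw [hτ₀]; exact div_le_div_of_nonneg_right (by nlinarith) hG2.le
  have hνG : 0 < ν / G ^ 2 := by positivity
  have ht₁pos : 3 * (ν / G ^ 2) ≤ t₁ := by rwa [mul_div_assoc] at ht₁
  -- the cell lies in the super-level set
  have hcell : ∀ τ ∈ Ioc (t₁ - τ₀) t₁, ∀ x ∈ ball x₁ r, G / 2 < ‖u τ x‖ := by
    intro τ hτ x hx
    -- spatial step at time `t₁`
    have hgrad : ∀ y, ‖fderiv ℝ (u t₁) y‖ ≤ Cg' * G ^ 2 / ν := by
      intro y
      have h := hCg hν hG hcl hT' hT'T hbd hKtop hL2 t₁ ⟨by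
        rw [one_mul]; linarith, ht₁T'⟩ y
      exact h.trans (div_le_div_of_nonneg_right
        (mul_le_mul_of_nonneg_right (le_max_left _ _) hG2.le) hν.le)
    have hsp : ‖u t₁ x - u t₁ x₁‖ ≤ Cg' * G ^ 2 / ν * ‖x - x₁‖ := by
      have hdiff : ∀ w ∈ (univ : Set (EuclideanSpace ℝ (Fin 3))), DifferentiableAt ℝ (u t₁) w :=
        fun w _ => ((hcl.contDiff_velocity ⟨by linarith, ht₁T'.trans hT'T⟩).differentiable
          (by simp)) w
      exact convex_univ.norm_image_sub_le_of_norm_fderiv_le hdiff (fun w _ => hgrad w)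
        (mem_univ x₁) (mem_univ x)
    have hsp' : ‖u t₁ x - u t₁ x₁‖ < G / 16 := by
      have hx' : ‖x - x₁‖ < r := by rwa [mem_ball, dist_eq_norm] at hx
      calc ‖u t₁ x - u t₁ x₁‖ ≤ Cg' * G ^ 2 / ν * ‖x - x₁‖ := hsp
        _ < Cg' * G ^ 2 / ν * r := by gcongr
        _ = G / 16 := by rw [hr]; field_simp
    -- time step from `τ` to `t₁`
    have htime : ‖u t₁ x - u τ x‖ ≤ G / 8 := by
      rcases eq_or_lt_of_le hτ.2 with heq | hlt
      · rw [heq, sub_self, norm_zero]; positivity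
      · have hτ1 : 1 * ν / G ^ 2 < τ := by
          rw [one_mul]
          have := hτ.1
          linarith
        have h := hCi hν hG hcl hT' hT'T hbd hKtop hL2 τ t₁ hτ1 hlt ht₁T' (by linarith [hτ.1]) x
        refine h.trans ?_
        have hCi_le : Ci * G ^ 2 * Real.sqrt ((t₁ - τ) / ν) ≤ Ci' * G ^ 2 * Real.sqrt (τ₀ / ν) := by
          have h1 : Real.sqrt ((t₁ - τ) / ν) ≤ Real.sqrt (τ₀ / ν) :=
            Real.sqrt_le_sqrt (div_le_div_of_nonneg_right (by linarith [hτ.1]) hν.le)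
          calc Ci * G ^ 2 * Real.sqrt ((t₁ - τ) / ν) ≤ Ci' * G ^ 2 * Real.sqrt ((t₁ - τ) / ν) := by
                gcongr; exact le_max_left _ _
            _ ≤ Ci' * G ^ 2 * Real.sqrt (τ₀ / ν) := by gcongr
        refine hCi_le.trans ?_
        have hsq : Real.sqrt (τ₀ / ν) = 1 / (8 * Ci' * G) := by
          rw [hτ₀, hκ₁]
          rw [show 1 / (64 * Ci' ^ 2) * ν / G ^ 2 / ν = (1 / (8 * Ci' * G)) ^ 2 by field_simp; ring]
          exact Real.sqrt_sq (by positivity)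
        rw [hsq]
        have : Ci' * G ^ 2 * (1 / (8 * Ci' * G)) = G / 8 := by field_simp
        rw [this]
    -- triangle inequality
    have h1 : ‖u t₁ x₁‖ ≤ ‖u τ x‖ + ‖u t₁ x - u τ x‖ + ‖u t₁ x - u t₁ x₁‖ := by
      calc ‖u t₁ x₁‖ = ‖u τ x + (u t₁ x - u τ x) - (u t₁ x - u t₁ x₁)‖ := by congr 1; abel
        _ ≤ ‖u τ x + (u t₁ x - u τ x)‖ + ‖u t₁ x - u t₁ x₁‖ := norm_sub_le _ _
        _ ≤ ‖u τ x‖ + ‖u t₁ x - u τ x‖ + ‖u t₁ x - u t₁ x₁‖ := by gcongr; exact norm_add_le _ _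
    linarith
  -- measure of the cell
  have hsubI : Ioo (t₁ - τ₀) t₁ ⊆ Ioo 0 T' := by
    intro τ hτ
    refine ⟨?_, hτ.2.trans ht₁T'⟩
    have : τ₀ ≤ ν / G ^ 2 := hτ₀le
    linarith [hτ.1]
  have hball : ∀ τ ∈ Ioo (t₁ - τ₀) t₁, volume (ball x₁ r) ≤ volume {x | G / 2 < ‖u τ x‖} :=
    fun τ hτ => measure_mono fun x hx => hcell τ ⟨hτ.1, hτ.2.le⟩ x hx
  have hvol : volume (ball x₁ r) = ENNReal.ofReal (r ^ 3) * ω := by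
    rw [hω, Measure.addHaar_ball volume x₁ hrpos.le, finrank_euclideanSpace_fin]
  calc ENNReal.ofReal (κ₁ * (1 / (16 * Cg')) ^ 3 * ω.toReal * ν ^ 4 / G ^ 5)
      = ENNReal.ofReal τ₀ * (ENNReal.ofReal (r ^ 3) * ω) := by
        conv_rhs => rw [← ENNReal.ofReal_toReal hωtop, ← ENNReal.ofReal_mul (by positivity),
          ← ENNReal.ofReal_mul (by positivity)]
        congr 1
        rw [hτ₀, hr]
        field_simp
    _ = ∫⁻ _ in Ioo (t₁ - τ₀) t₁, volume (ball x₁ r) := by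
        rw [setLIntegral_const, hvol, Real.volume_Ioo, sub_sub_cancel, mul_comm]
    _ ≤ ∫⁻ τ in Ioo (t₁ - τ₀) t₁, volume {x | G / 2 < ‖u τ x‖} :=
        setLIntegral_mono' measurableSet_Ioo fun τ hτ => hball τ hτ
    _ ≤ ∫⁻ τ in Ioo 0 T', volume {x | G / 2 < ‖u τ x‖} := lintegral_mono_set hsubI

end Summit.NavierStokesRegularity.NavierStokesRegularity.Theorems

end
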